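import Summits.ResolutionOfSingularities.ResolutionOfSingularities.Theorems.EquisingularLiftEquisingularLiftOrdinaryPointsJacobianTransport
import Literature.AlgebraicGeometry.Motives.GeneralNonsingularForms
import HarnessLib

/-!
# [OURS · tools] NONSINGULAR FORMS UNDER INVERTIBLE LINEAR SUBSTITUTIONS AND SCALARS; the constant term of a chart
# (toward the intrinsic «ordinary multiple points in general position» theorem of cruxes `EquisingularLiftNat(Three)` / `EquisingularLift`)

[OURS · leafhand-res-equisingularlift-7 g1, 2026-08-31; cell `pub/decomp-res`] AI-produced, weaker than expert review; NOT a statement of any manuscript.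
DEF-FREE helper; no `sorry`; standard axioms.

* ★ `MultiOrd.isNonsingularForm_aeval_of_linSubst` — `K = K̄`: for mutually inverse linear substitutions `τ, τ'`, `Φ` nonsingular ⇒ `σ_{τ'} Φ` nonsingular
  (✓ `jacobian_of_linSubst` with the EMPTY marking: the singular points of `σ_{τ'}Φ` are the `τ`-coordinates of those of `Φ`; closed-point criterion
  ✓ `isNonsingularForm_iff_forall_exists_eval_pderiv_ne_zero`);
* `MultiOrd.isNonsingularForm_C_mul` — `Φ` nonsingular, `s ≠ 0` ⇒ `C s · Φ` nonsingular;
* `MultiOrd.constantCoeff_dehomogenize` — the constant term of the chart `q(x_c := 1)` is the value `q(e_c)` at the vertex.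

These are items (i) of the census in ✓ `…OrdinaryPointsChartExpansion`: with ✓ `dehomogenize_aeval_eq_initial_add` they leave, for the intrinsic multi-point
theorem, only the invertibility of the linear part `M` of a vertex-fixing substitution and the final assembly.

References: [Hartshorne1977, I Ex. 5.8]; [Humphreys1990, §3.10].
-/

set_option linter.dupNamespace false -- mandated namespace `Summit.<Summit>.<Problem>` of this single-conjunct summit

noncomputable section

open MvPolynomial
open Literature.AlgebraicGeometry.Motives Literature.AlgebraicGeometry.Motives.SmoothHypersurface
open Literature.AlgebraicGeometry.Motives.ProjectiveSpace

namespace Summit.ResolutionOfSingularities.ResolutionOfSingularities.Cruxes.EquisingularLiftNat.Sections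

namespace MultiOrd

variable {K : Type} [Field K]

/-- ★ **Nonsingular forms stay nonsingular under invertible linear substitutions** (`K = K̄`): `τ, τ'` mutually inverse linear substitutions,
`Φ` nonsingular ⇒ `σ_{τ'} Φ` nonsingular.  A singular point `a ≠ 0` of `σ_{τ'}Φ` would give the singular point `τ'(a) ≠ 0` of `Φ`
(✓ `jacobian_of_linSubst`, empty marking). [cite: Hartshorne1977, I Ex. 5.8] -/
theorem isNonsingularForm_aeval_of_linSubst [IsAlgClosed K] {n : ℕ} (τ τ' : Fin (n + 1 + 1) → MvPolynomial (Fin (n + 1 + 1)) K)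
    (hτ : ∀ i, (τ i).IsHomogeneous 1) (hinv : ∀ i, aeval τ (τ' i) = X i) (hinv' : ∀ i, aeval τ' (τ i) = X i)
    {Φ : MvPolynomial (Fin (n + 1 + 1)) K} (hΦ : IsNonsingularForm K Φ) : IsNonsingularForm K (aeval τ' Φ) := by
  rw [isNonsingularForm_iff_forall_exists_eval_pderiv_ne_zero] at hΦ ⊢
  intro z hz h0
  by_contra hall
  push Not at hall
  obtain ⟨c, hc, -⟩ := jacobian_of_linSubst τ τ' hτ hinv hinv' [] Φ
    (fun b hb hb0 hbd => by obtain ⟨j, hj⟩ := hΦ b hb hb0; exact absurd (hbd j) hj) z hz h0 hall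
  simp at hc

/-- **A non-zero scalar multiple of a nonsingular form is nonsingular.** [folklore] -/
theorem isNonsingularForm_C_mul {n : ℕ} {Φ : MvPolynomial (Fin (n + 2)) K} (hΦ : IsNonsingularForm K Φ) {s : K} (hs : s ≠ 0) :
    IsNonsingularForm K (C s * Φ) := by
  intro 𝔭 h𝔭 hF hd i
  have hu : IsUnit (C s : MvPolynomial (Fin (n + 2)) K) := (isUnit_iff_ne_zero.mpr hs).map C
  refine hΦ 𝔭 h𝔭 ((Ideal.unit_mul_mem_iff_mem 𝔭 hu).mp hF) (fun j => ?_) i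
  have h := hd j
  rw [Derivation.leibniz, pderiv_C, smul_zero, add_zero, smul_eq_mul] at h
  exact (Ideal.unit_mul_mem_iff_mem 𝔭 hu).mp h

/-- **The constant term of the chart is the value at the vertex**: `q(x_c := 1)(0) = q(e_c)`. [folklore] -/
theorem constantCoeff_dehomogenize {N : ℕ} (c : Fin (N + 1)) (q : MvPolynomial (Fin (N + 1)) K) :
    constantCoeff (ProjectiveSpace.dehomogenize K c q) = eval (Pi.single c 1 : Fin (N + 1) → K) q := by
  have h := ProjectiveSpace.eval_dehomogenize c (Pi.single c 1 : Fin (N + 1) → K) (by simp) q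
  rw [← h, show (fun j => (Pi.single c 1 : Fin (N + 1) → K) (c.succAbove j)) = fun _ => 0 from
    funext fun j => by simp [Fin.succAbove_ne c j], eval_zero']

end MultiOrd

end Summit.ResolutionOfSingularities.ResolutionOfSingularities.Cruxes.EquisingularLiftNat.Sections

end
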